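import Literature.MathematicalPhysics.QuantumLattice.SpectralProjectionDerivProofs
import Literature.MathematicalPhysics.QuantumLattice.FinDimSpectrumSectorGibbsLimit
import Literature.MathematicalPhysics.QuantumLattice.LTQOProofs

/-!
# Route `AnisotropyChord`: the rank-one resolvent branch — monotonicity of the flat overlap along the
# ground-state branch of `L + σ|s⟩⟨s|` (abstract linear algebra; the engine of the two-magnon rung
# TM-VT of `U_vt` on edge-transitive graphs, file `…SpinMonotoneTwoMagnonEdgeTransitive`)

Setting (all vectors in `ι → ℂ`, `ι` finite): `L` positive semidefinite with a unit kernel vector `e`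
(`L e = 0`), a vector `s` with `⟨e, s⟩ ≠ 0`, an `L`-invariant subspace `𝓜 ∋ e, s`, and for
`i = 1, 2` unit vectors `ψᵢ` with

  `L ψᵢ + σᵢ ⟨s, ψᵢ⟩ s = εᵢ ψᵢ`,  `0 < σ₂`,  `ε₂ ≤ ε₁` (⇔ `σ₂ ≤ σ₁` on the ground branch),

`ψ₂ ∈ 𝓜`, `⟨s, ψ₂⟩ ≠ 0`, the VARIATIONAL property of `ε₁` on `𝓜 ∩ s^⊥`
(`ε₁‖f‖² ≤ ⟨f, L f⟩`) and the UNIQUENESS property of `ε₂` on `𝓜 ∩ s^⊥` (no nonzero `g` with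
`L g = ε₂ g`).  This is the situation of the ground states of the rank-one family
`H_σ = L + σ|s⟩⟨s|` restricted to `𝓜` (theory seat `hubbard-h0-rotor-theory-1`, cycle 4, §22–23:
`H_σ = ½L_X + σ ê` on the `Aut`-invariant two-magnon block of an edge-transitive graph, where the
contact operator `ê` is rank one).

**Theorem** (`flatOverlap_sq_le_of_rankOne_branch`): `|⟨e, ψ₁⟩|² ≤ |⟨e, ψ₂⟩|²` — the overlap with
the flat (kernel) vector is non-increasing in the coupling `σ` along the ground-state branch.

Proof (derivative-free; eigenbasis `(v_j, λ_j)` of `L`, `a_j = ⟨v_j, s⟩`):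
`(λ_j − εᵢ)⟨v_j, ψᵢ⟩ = −σᵢ⟨s,ψᵢ⟩ a_j`, `εᵢ⟨e,ψᵢ⟩ = σᵢ⟨s,ψᵢ⟩⟨e,s⟩`, hence by Parseval
`|⟨e,ψᵢ⟩|² ≤ |⟨e,s⟩|² / Σ_j |a_j|² εᵢ²/(λ_j − εᵢ)²` with EQUALITY for `ψ₂` (uniqueness kills the
components of `ψ₂` on `ker(L − ε₂)`), and the variational property gives `λ_j > ε₁ ≥ ε₂ > 0`
whenever `a_j ≠ 0 ≠ λ_j` (test vector `⟨s, Q v_j⟩ e − ⟨s, e⟩ Q v_j`, `Q` the orthogonal projection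
onto `𝓜`, which commutes with `L`), so each `|a_j|² ε²/(λ_j − ε)²` is non-decreasing in `ε` on
`[ε₂, ε₁]` (interlacing of a rank-one perturbation, done by hand).  The theory seat's Theorem
(one contact orbit, §22.3) is the `σ`-derivative of this statement; no derivative, resolvent or
analytic perturbation theory is used here.

Tools: Mathlib's `Matrix.IsHermitian.eigenvectorBasis` + `OrthonormalBasis.sum_sq_norm_inner_right`
(Parseval), the tree's `eigenvector_dotProduct_mulVec_self`, `mulVec_eigenvectorBasis_coe`, and the
orthogonal projection matrix `projMatrix` (`projMatrix_map_commute_of_invariant`,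
`projMatrix_map_mulVec_of_mem`, `projMatrix_map_mulVec_mem`).  H. Tasaki, *Physics and Mathematics
of Quantum Many-Body Systems* (2020) App. A.2–A.3 (variational principle, min–max); B. Simon, *Trace
Ideals* (2005) §11 (rank-one perturbations).  No definition is introduced.
-/

set_option linter.dupNamespace false

noncomputable section

namespace Summit.HubbardSuperconductivity.HubbardSuperconductivity.Theorems.AnisotropyChord

open Matrix Complex Finset
open scoped ComplexOrder InnerProductSpace
open Literature.MathematicalPhysics.QuantumLattice

variable {ι : Type*} [Fintype ι] [DecidableEq ι]

/-! ### Coefficients in the eigenbasis of a Hermitian matrix -/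

omit [DecidableEq ι] in
/-- The coefficient `star v ⬝ᵥ x` against a vector of `EuclideanSpace ℂ ι` is the inner product.
[folklore] -/
theorem star_coe_dotProduct_eq_inner (v : EuclideanSpace ℂ ι) (x : ι → ℂ) :
    star (v : ι → ℂ) ⬝ᵥ x = ⟪v, WithLp.toLp 2 x⟫_ℂ := by
  rw [EuclideanSpace.inner_eq_star_dotProduct, dotProduct_comm]

omit [DecidableEq ι] in
/-- **Parseval in an orthonormal basis, dot-product form**: `re⟨x, x⟩ = Σ_j |star b_j ⬝ᵥ x|²`.
[folklore] -/
theorem re_star_dotProduct_self_eq_sum (b : OrthonormalBasis ι ℂ (EuclideanSpace ℂ ι))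
    (x : ι → ℂ) : (star x ⬝ᵥ x).re = ∑ j, ‖star (b j : ι → ℂ) ⬝ᵥ x‖ ^ 2 := by
  have h := inner_self_eq_norm_sq_to_K (𝕜 := ℂ) (WithLp.toLp 2 x : EuclideanSpace ℂ ι)
  rw [EuclideanSpace.inner_eq_star_dotProduct, dotProduct_comm] at h
  have h1 : (star x ⬝ᵥ x).re = ‖(WithLp.toLp 2 x : EuclideanSpace ℂ ι)‖ ^ 2 := by
    have h2 : star x ⬝ᵥ x = ((‖(WithLp.toLp 2 x : EuclideanSpace ℂ ι)‖ : ℝ) : ℂ) ^ 2 := h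
    rw [h2, ← Complex.ofReal_pow, Complex.ofReal_re]
  rw [h1, ← b.sum_sq_norm_inner_right]
  refine Finset.sum_congr rfl fun j _ => ?_
  rw [star_coe_dotProduct_eq_inner]

omit [DecidableEq ι] in
/-- `|z|²` as `z̄ z`: `(star z * z).re = ‖z‖²`. [folklore] -/
theorem re_star_mul_self_eq_norm_sq (z : ℂ) : (star z * z).re = ‖z‖ ^ 2 := by
  rw [Complex.star_def, Complex.conj_mul', ← Complex.ofReal_pow, Complex.ofReal_re]

omit [DecidableEq ι] in
/-- Pairing with a kernel vector of a Hermitian matrix kills `L`: `star e ⬝ᵥ (L x) = 0` if `L e = 0`.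
[folklore] -/
theorem star_dotProduct_mulVec_eq_zero_of_kernel {L : Matrix ι ι ℂ} (hL : L.IsHermitian)
    {e : ι → ℂ} (he : L *ᵥ e = 0) (x : ι → ℂ) : star e ⬝ᵥ (L *ᵥ x) = 0 := by
  rw [dotProduct_mulVec, show star e ᵥ* L = star (Lᴴ *ᵥ e) by rw [star_mulVec, conjTranspose_conjTranspose],
    hL.eq, he, star_zero, zero_dotProduct]

/-! ### The rank-one resolvent branch -/

/-- Elementary monotonicity: for `0 < ε₂ ≤ ε₁ < λ`, `ε₂²/(λ − ε₂)² ≤ ε₁²/(λ − ε₁)²`. [folklore] -/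
theorem sq_div_sq_mono {lam ε₁ ε₂ : ℝ} (h2 : 0 < ε₂) (h12 : ε₂ ≤ ε₁) (h1 : ε₁ < lam) :
    ε₂ ^ 2 / (lam - ε₂) ^ 2 ≤ ε₁ ^ 2 / (lam - ε₁) ^ 2 := by
  have hd1 : 0 < lam - ε₁ := sub_pos.2 h1
  have hd2 : 0 < lam - ε₂ := by linarith
  rw [← div_pow, ← div_pow]
  apply pow_le_pow_left₀ (div_nonneg h2.le hd2.le)
  rw [div_le_div_iff₀ hd2 hd1]
  nlinarith

/-- **Monotonicity of the flat overlap along the ground branch of a rank-one family** (abstract form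
of the two-magnon rung on edge-transitive graphs; see the module docstring for the setting and the
proof). For `L ⪰ 0` with unit kernel vector `e`, `⟨e,s⟩ ≠ 0`, an `L`-invariant subspace `𝓜 ∋ e, s, ψ₂`,
unit vectors `ψᵢ` with `L ψᵢ + σᵢ⟨s,ψᵢ⟩ s = εᵢ ψᵢ` (`0 < σ₂`, `ε₂ ≤ ε₁` — on the ground branch
this is `σ₂ ≤ σ₁` — and `⟨s,ψ₂⟩ ≠ 0`), the
variational property of `ε₁` and the uniqueness property of `ε₂` on `𝓜 ∩ s^⊥`:
`|⟨e, ψ₁⟩|² ≤ |⟨e, ψ₂⟩|²`. Tasaki (2020) App. A.2–A.3; Simon, *Trace Ideals* §11. [folklore] -/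
theorem flatOverlap_sq_le_of_rankOne_branch {L : Matrix ι ι ℂ} (hL : L.PosSemidef)
    (𝓜 : Submodule ℂ (ι → ℂ)) (h𝓜 : ∀ v ∈ 𝓜, L *ᵥ v ∈ 𝓜)
    {e s ψ₁ ψ₂ : ι → ℂ} (he𝓜 : e ∈ 𝓜) (hs𝓜 : s ∈ 𝓜) (hψ₂𝓜 : ψ₂ ∈ 𝓜)
    (hLe : L *ᵥ e = 0) (he1 : star e ⬝ᵥ e = 1) (ha0 : star e ⬝ᵥ s ≠ 0)
    {σ₁ σ₂ ε₁ ε₂ : ℝ} (hσ₂ : 0 < σ₂) (hε : ε₂ ≤ ε₁)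
    (h₁ : L *ᵥ ψ₁ + ((σ₁ : ℂ) * (star s ⬝ᵥ ψ₁)) • s = (ε₁ : ℂ) • ψ₁) (hψ₁n : star ψ₁ ⬝ᵥ ψ₁ = 1)
    (h₂ : L *ᵥ ψ₂ + ((σ₂ : ℂ) * (star s ⬝ᵥ ψ₂)) • s = (ε₂ : ℂ) • ψ₂) (hψ₂n : star ψ₂ ⬝ᵥ ψ₂ = 1)
    (hb₂ : star s ⬝ᵥ ψ₂ ≠ 0)
    (hvar : ∀ f ∈ 𝓜, star s ⬝ᵥ f = 0 → ε₁ * (star f ⬝ᵥ f).re ≤ (star f ⬝ᵥ (L *ᵥ f)).re)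
    (huniq : ∀ g ∈ 𝓜, star s ⬝ᵥ g = 0 → L *ᵥ g = (ε₂ : ℂ) • g → g = 0) :
    ‖star e ⬝ᵥ ψ₁‖ ^ 2 ≤ ‖star e ⬝ᵥ ψ₂‖ ^ 2 := by
  have hH : L.IsHermitian := hL.1
  -- eigenbasis
  set v : ι → (ι → ℂ) := fun j => (hH.eigenvectorBasis j : ι → ℂ) with hvdef
  set lam : ι → ℝ := hH.eigenvalues with hlamdef
  have hlam0 : ∀ j, 0 ≤ lam j := fun j => hL.eigenvalues_nonneg j
  have hLv : ∀ j, L *ᵥ v j = ((lam j : ℝ) : ℂ) • v j := fun j => mulVec_eigenvectorBasis_coe hH j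
  have hcoef : ∀ j x, star (v j) ⬝ᵥ (L *ᵥ x) = (lam j : ℂ) * (star (v j) ⬝ᵥ x) :=
    fun j x => eigenvector_dotProduct_mulVec_self hH j x
  have parseval : ∀ x : ι → ℂ, (star x ⬝ᵥ x).re = ∑ j, ‖star (v j) ⬝ᵥ x‖ ^ 2 :=
    fun x => re_star_dotProduct_self_eq_sum hH.eigenvectorBasis x
  -- names
  set a : ι → ℂ := fun j => star (v j) ⬝ᵥ s with hadef
  set a₀ : ℂ := star e ⬝ᵥ s with ha₀def
  -- (E1) coefficient equations
  have E1 : ∀ (σ ε : ℝ) (ψ : ι → ℂ), L *ᵥ ψ + ((σ : ℂ) * (star s ⬝ᵥ ψ)) • s = (ε : ℂ) • ψ →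
      ∀ j, ((lam j : ℂ) - ε) * (star (v j) ⬝ᵥ ψ) = -((σ : ℂ) * (star s ⬝ᵥ ψ)) * a j := by
    intro σ ε ψ h j
    have h' := congrArg (fun y => star (v j) ⬝ᵥ y) h
    simp only [dotProduct_add, dotProduct_smul, smul_eq_mul, hcoef] at h'
    rw [hadef]
    linear_combination h'
  -- (E2) pairing with the kernel vector
  have E2 : ∀ (σ ε : ℝ) (ψ : ι → ℂ), L *ᵥ ψ + ((σ : ℂ) * (star s ⬝ᵥ ψ)) • s = (ε : ℂ) • ψ →
      (ε : ℂ) * (star e ⬝ᵥ ψ) = (σ : ℂ) * (star s ⬝ᵥ ψ) * a₀ := by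
    intro σ ε ψ h
    have h' := congrArg (fun y => star e ⬝ᵥ y) h
    simp only [dotProduct_add, dotProduct_smul, smul_eq_mul,
      star_dotProduct_mulVec_eq_zero_of_kernel hH hLe, zero_add] at h'
    rw [ha₀def]
    linear_combination -h'
  -- (E3) energies: `εᵢ = ⟨ψᵢ, Lψᵢ⟩ + σᵢ |bᵢ|²`, so `ε₂ > 0`
  have E3 : ∀ (σ ε : ℝ) (ψ : ι → ℂ), L *ᵥ ψ + ((σ : ℂ) * (star s ⬝ᵥ ψ)) • s = (ε : ℂ) • ψ →
      star ψ ⬝ᵥ ψ = 1 → ε = (star ψ ⬝ᵥ (L *ᵥ ψ)).re + σ * ‖star s ⬝ᵥ ψ‖ ^ 2 := by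
    intro σ ε ψ h hn
    have h' := congrArg (fun y => (star ψ ⬝ᵥ y).re) h
    simp only [dotProduct_add, dotProduct_smul, smul_eq_mul, hn, mul_one, Complex.add_re,
      Complex.ofReal_re] at h'
    have hss : star ψ ⬝ᵥ s = star (star s ⬝ᵥ ψ) := star_dotProduct ψ s
    rw [hss, show ((σ : ℂ) * (star s ⬝ᵥ ψ) * star (star s ⬝ᵥ ψ)).re = σ * ‖star s ⬝ᵥ ψ‖ ^ 2 by
      rw [mul_assoc, Complex.re_ofReal_mul, mul_comm (star s ⬝ᵥ ψ), re_star_mul_self_eq_norm_sq]] at h'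
    exact h'.symm
  have hε₂pos : 0 < ε₂ := by
    rw [E3 σ₂ ε₂ ψ₂ h₂ hψ₂n]
    have h1 : 0 ≤ (star ψ₂ ⬝ᵥ (L *ᵥ ψ₂)).re := (Complex.le_def.1 (hL.dotProduct_mulVec_nonneg ψ₂)).1
    have h2 : 0 < ‖star s ⬝ᵥ ψ₂‖ ^ 2 := by positivity
    nlinarith
  have hε₁pos : 0 < ε₁ := lt_of_lt_of_le hε₂pos hε
  -- the orthogonal projection onto `𝓜`
  set Q := projMatrix (𝓜.map ((WithLp.linearEquiv 2 ℂ (ι → ℂ)).symm :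
    (ι → ℂ) →ₗ[ℂ] EuclideanSpace ℂ ι)) with hQdef
  have hQh : Q.IsHermitian := projMatrix_isHermitian _
  -- `star (Q x) ⬝ᵥ y = star x ⬝ᵥ (Q y)` (cf. the tree's `CooperPairDMottWalk` Schur file)
  have hQadj : ∀ x y : ι → ℂ, star (Q *ᵥ x) ⬝ᵥ y = star x ⬝ᵥ (Q *ᵥ y) := fun x y => by
    rw [star_mulVec, hQh.eq, ← dotProduct_mulVec]
  have hQmem : ∀ x, Q *ᵥ x ∈ 𝓜 := fun x => projMatrix_map_mulVec_mem 𝓜 x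
  have hQfix : ∀ x ∈ 𝓜, Q *ᵥ x = x := fun x hx => projMatrix_map_mulVec_of_mem 𝓜 hx
  have hQL : Q * L = L * Q := projMatrix_map_commute_of_invariant hH 𝓜 h𝓜
  have hQQ : ∀ x, Q *ᵥ (Q *ᵥ x) = Q *ᵥ x := fun x => hQfix _ (hQmem x)
  -- projected eigenvectors
  have hLQv : ∀ j, L *ᵥ (Q *ᵥ v j) = ((lam j : ℝ) : ℂ) • (Q *ᵥ v j) := by
    intro j
    rw [mulVec_mulVec, ← hQL, ← mulVec_mulVec, hLv, mulVec_smul]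
  have hsQv : ∀ j, star s ⬝ᵥ (Q *ᵥ v j) = star (a j) := by
    intro j
    rw [← hQadj, hQfix s hs𝓜, hadef]
    exact star_dotProduct s (v j)
  -- `e ⊥ v_j` for `λ_j ≠ 0`
  have heperp : ∀ j, lam j ≠ 0 → star (v j) ⬝ᵥ e = 0 := by
    intro j hj
    have h := hcoef j e
    rw [hLe, dotProduct_zero] at h
    rcases mul_eq_zero.1 h.symm with h1 | h1
    · exact absurd (by exact_mod_cast h1 : lam j = 0) hj
    · exact h1
  have heQv : ∀ j, lam j ≠ 0 → star e ⬝ᵥ (Q *ᵥ v j) = 0 := by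
    intro j hj
    rw [← hQadj, hQfix e he𝓜, star_dotProduct, heperp j hj,
      star_zero]
  -- Step A: `λ_j > ε₁` whenever `a_j ≠ 0 ≠ λ_j`
  have stepA : ∀ j, a j ≠ 0 → lam j ≠ 0 → ε₁ < lam j := by
    intro j haj hlj
    set g := Q *ᵥ v j with hgdef
    have hg𝓜 : g ∈ 𝓜 := hQmem _
    have hgs : star s ⬝ᵥ g = star (a j) := hsQv j
    have hge : star e ⬝ᵥ g = 0 := heQv j hlj
    have hg0 : g ≠ 0 := by
      intro h0
      rw [h0, dotProduct_zero] at hgs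
      exact haj (star_eq_zero.1 hgs.symm)
    have hgpos : 0 < (star g ⬝ᵥ g).re := by
      have h := Matrix.dotProduct_star_self_pos_iff.2 hg0
      have h2 := (Complex.lt_def.1 h).1
      rw [Complex.zero_re] at h2
      exact h2
    -- test vector `f = ⟨s, g⟩ e − ⟨s, e⟩ g ∈ 𝓜 ∩ s^⊥`
    set α : ℂ := star s ⬝ᵥ g with hαdef
    set β : ℂ := star s ⬝ᵥ e with hβdef
    set f := α • e - β • g with hfdef
    have hf𝓜 : f ∈ 𝓜 := 𝓜.sub_mem (𝓜.smul_mem _ he𝓜) (𝓜.smul_mem _ hg𝓜)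
    have hfs : star s ⬝ᵥ f = 0 := by
      rw [hfdef, dotProduct_sub, dotProduct_smul, dotProduct_smul, smul_eq_mul, smul_eq_mul,
        ← hαdef, ← hβdef]
      ring
    have hge' : star g ⬝ᵥ e = 0 := by
      rw [star_dotProduct g e, hge, star_zero]
    have hLf : L *ᵥ f = -(β * (lam j : ℂ)) • g := by
      rw [hfdef, mulVec_sub, mulVec_smul, mulVec_smul, hLe, smul_zero, zero_sub, hgdef, hLQv j,
        smul_smul, neg_smul]
    have hff_c : star f ⬝ᵥ f = star α * α + star β * β * (star g ⬝ᵥ g) := by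
      rw [hfdef]
      simp only [star_sub, star_smul, sub_dotProduct, smul_dotProduct, dotProduct_sub,
        dotProduct_smul, smul_eq_mul, he1, hge, hge']
      ring
    have hfLf_c : star f ⬝ᵥ (L *ᵥ f) = star β * β * (lam j : ℂ) * (star g ⬝ᵥ g) := by
      rw [hLf, dotProduct_smul, smul_eq_mul, hfdef]
      simp only [star_sub, star_smul, sub_dotProduct, smul_dotProduct, smul_eq_mul, hge]
      ring
    have hreβ : ∀ X : ℂ, (star β * β * X).re = ‖β‖ ^ 2 * X.re := by
      intro X
      rw [Complex.star_def, Complex.conj_mul', ← Complex.ofReal_pow, Complex.re_ofReal_mul]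
    have hff : (star f ⬝ᵥ f).re = ‖α‖ ^ 2 + ‖β‖ ^ 2 * (star g ⬝ᵥ g).re := by
      rw [hff_c, Complex.add_re, re_star_mul_self_eq_norm_sq, hreβ]
    have hfLf : (star f ⬝ᵥ (L *ᵥ f)).re = ‖β‖ ^ 2 * (lam j * (star g ⬝ᵥ g).re) := by
      rw [hfLf_c, mul_assoc, hreβ, Complex.re_ofReal_mul]
    have hαpos : 0 < ‖α‖ ^ 2 := by
      have : α ≠ 0 := by rw [hgs]; exact star_ne_zero.2 haj
      positivity
    have hβpos : 0 < ‖β‖ ^ 2 := by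
      have : β ≠ 0 := by
        rw [hβdef, star_dotProduct s e]
        exact star_ne_zero.2 ha0
      positivity
    have hv := hvar f hf𝓜 hfs
    rw [hff, hfLf] at hv
    -- `ε₁ (|α|² + |β|² ‖g‖²) ≤ |β|² λ ‖g‖²` with `|α|² > 0` forces `ε₁ < λ`
    by_contra hle
    push Not at hle
    have h1 : ‖β‖ ^ 2 * (lam j * (star g ⬝ᵥ g).re) ≤ ‖β‖ ^ 2 * (ε₁ * (star g ⬝ᵥ g).re) :=
      mul_le_mul_of_nonneg_left (mul_le_mul_of_nonneg_right hle hgpos.le) hβpos.le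
    nlinarith [mul_pos hε₁pos hαpos, mul_nonneg hβpos.le (mul_nonneg hε₁pos.le hgpos.le)]
  -- Step B: `ψ₂` has no component on `ker(L − ε₂)`
  have stepB : ∀ j, lam j = ε₂ → star (v j) ⬝ᵥ ψ₂ = 0 := by
    intro j hj
    have haj : a j = 0 := by
      have h := E1 σ₂ ε₂ ψ₂ h₂ j
      rw [hj, sub_self, zero_mul] at h
      have hσb : (σ₂ : ℂ) * (star s ⬝ᵥ ψ₂) ≠ 0 := mul_ne_zero (by exact_mod_cast hσ₂.ne') hb₂
      rcases mul_eq_zero.1 h.symm with h1 | h1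
      · exact absurd (neg_eq_zero.1 h1) hσb
      · exact h1
    have hg0 : Q *ᵥ v j = 0 :=
      huniq _ (hQmem _) (by rw [hsQv j, haj, star_zero]) (by rw [hLQv j, hj])
    calc star (v j) ⬝ᵥ ψ₂ = star (v j) ⬝ᵥ (Q *ᵥ ψ₂) := by rw [hQfix ψ₂ hψ₂𝓜]
      _ = star (Q *ᵥ v j) ⬝ᵥ ψ₂ := (hQadj _ _).symm
      _ = 0 := by rw [hg0, star_zero, zero_dotProduct]
  -- coefficient sizes along the branch
  set T : ℝ → ι → ℝ := fun ε j => ‖a j‖ ^ 2 / (lam j - ε) ^ 2 with hTdef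
  have hcoefsq : ∀ (σ ε : ℝ) (ψ : ι → ℂ), L *ᵥ ψ + ((σ : ℂ) * (star s ⬝ᵥ ψ)) • s = (ε : ℂ) • ψ →
      ∀ j, lam j ≠ ε → ‖star (v j) ⬝ᵥ ψ‖ ^ 2 = σ ^ 2 * ‖star s ⬝ᵥ ψ‖ ^ 2 * T ε j := by
    intro σ ε ψ h j hj
    have h' := E1 σ ε ψ h j
    have hne : ((lam j : ℂ) - ε) ≠ 0 := by
      intro h0
      apply hj
      exact_mod_cast sub_eq_zero.1 h0
    have hp : star (v j) ⬝ᵥ ψ = -((σ : ℂ) * (star s ⬝ᵥ ψ)) * a j / ((lam j : ℂ) - ε) := by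
      rw [eq_div_iff hne, mul_comm]
      exact h'
    rw [hp, hTdef]
    simp only [← Complex.ofReal_sub, norm_div, norm_mul, norm_neg, Complex.norm_real,
      Real.norm_eq_abs, div_pow, mul_pow, sq_abs]
    ring
  have N2 : ∀ j, ‖star (v j) ⬝ᵥ ψ₂‖ ^ 2 = σ₂ ^ 2 * ‖star s ⬝ᵥ ψ₂‖ ^ 2 * T ε₂ j := by
    intro j
    by_cases hj : lam j = ε₂
    · rw [stepB j hj, hTdef]
      simp [hj]
    · exact hcoefsq σ₂ ε₂ ψ₂ h₂ j hj
  have N1 : ∀ j, σ₁ ^ 2 * ‖star s ⬝ᵥ ψ₁‖ ^ 2 * T ε₁ j ≤ ‖star (v j) ⬝ᵥ ψ₁‖ ^ 2 := by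
    intro j
    by_cases hj : lam j = ε₁
    · rw [hTdef]
      simp only [hj, sub_self, ne_eq, OfNat.ofNat_ne_zero, not_false_eq_true, zero_pow, div_zero,
        mul_zero]
      positivity
    · exact (hcoefsq σ₁ ε₁ ψ₁ h₁ j hj).symm.le
  set S₁ : ℝ := ∑ j, T ε₁ j with hS₁def
  set S₂ : ℝ := ∑ j, T ε₂ j with hS₂def
  have hS2 : σ₂ ^ 2 * ‖star s ⬝ᵥ ψ₂‖ ^ 2 * S₂ = 1 := by
    have h : ∑ j, ‖star (v j) ⬝ᵥ ψ₂‖ ^ 2 = 1 := by rw [← parseval, hψ₂n, Complex.one_re]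
    rw [hS₂def, Finset.mul_sum, ← h]
    exact Finset.sum_congr rfl fun j _ => (N2 j).symm
  have hS1 : σ₁ ^ 2 * ‖star s ⬝ᵥ ψ₁‖ ^ 2 * S₁ ≤ 1 := by
    have h : ∑ j, ‖star (v j) ⬝ᵥ ψ₁‖ ^ 2 = 1 := by rw [← parseval, hψ₁n, Complex.one_re]
    rw [hS₁def, Finset.mul_sum, ← h]
    exact Finset.sum_le_sum fun j _ => N1 j
  -- termwise monotonicity in `ε`
  have mono : ∀ j, ε₂ ^ 2 * T ε₂ j ≤ ε₁ ^ 2 * T ε₁ j := by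
    intro j
    by_cases haj : a j = 0
    · simp [hTdef, haj]
    · by_cases hlj : lam j = 0
      · have hε₁0 : ε₁ ≠ 0 := hε₁pos.ne'
        have hε₂0 : ε₂ ≠ 0 := hε₂pos.ne'
        have h2 : ε₂ ^ 2 * T ε₂ j = ‖a j‖ ^ 2 := by
          rw [hTdef]
          simp only
          rw [hlj, zero_sub, neg_sq]
          field_simp
        have h1 : ε₁ ^ 2 * T ε₁ j = ‖a j‖ ^ 2 := by
          rw [hTdef]
          simp only
          rw [hlj, zero_sub, neg_sq]
          field_simp
        rw [h1, h2]
      · have hlt := stepA j haj hlj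
        rw [hTdef]
        simp only
        calc ε₂ ^ 2 * (‖a j‖ ^ 2 / (lam j - ε₂) ^ 2) = ‖a j‖ ^ 2 * (ε₂ ^ 2 / (lam j - ε₂) ^ 2) := by
              ring
          _ ≤ ‖a j‖ ^ 2 * (ε₁ ^ 2 / (lam j - ε₁) ^ 2) :=
              mul_le_mul_of_nonneg_left (sq_div_sq_mono hε₂pos hε hlt) (by positivity)
          _ = ε₁ ^ 2 * (‖a j‖ ^ 2 / (lam j - ε₁) ^ 2) := by ring
  have hsum_mono : ε₂ ^ 2 * S₂ ≤ ε₁ ^ 2 * S₁ := by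
    rw [hS₁def, hS₂def, Finset.mul_sum, Finset.mul_sum]
    exact Finset.sum_le_sum fun j _ => mono j
  -- the overlaps `|cᵢ|² = σᵢ² |bᵢ|² |a₀|² / εᵢ²`
  have hcsq : ∀ (σ ε : ℝ) (ψ : ι → ℂ), L *ᵥ ψ + ((σ : ℂ) * (star s ⬝ᵥ ψ)) • s = (ε : ℂ) • ψ →
      ε ≠ 0 → ‖star e ⬝ᵥ ψ‖ ^ 2 = σ ^ 2 * ‖star s ⬝ᵥ ψ‖ ^ 2 * ‖a₀‖ ^ 2 / ε ^ 2 := by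
    intro σ ε ψ h hε0
    have h' := E2 σ ε ψ h
    have hε0' : (ε : ℂ) ≠ 0 := by exact_mod_cast hε0
    have hc : star e ⬝ᵥ ψ = (σ : ℂ) * (star s ⬝ᵥ ψ) * a₀ / ε := by
      rw [eq_div_iff hε0', mul_comm]
      exact h'
    rw [hc]
    simp only [norm_div, norm_mul, Complex.norm_real, Real.norm_eq_abs, div_pow, mul_pow, sq_abs]
  rw [hcsq σ₁ ε₁ ψ₁ h₁ hε₁pos.ne', hcsq σ₂ ε₂ ψ₂ h₂ hε₂pos.ne']
  -- final algebra
  have hX₂ : 0 ≤ σ₂ ^ 2 * ‖star s ⬝ᵥ ψ₂‖ ^ 2 := by positivity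
  have hS₂pos : 0 < S₂ := by
    by_contra h
    push Not at h
    nlinarith [mul_nonpos_of_nonneg_of_nonpos hX₂ h]
  have hP2 : 0 < ε₂ ^ 2 * S₂ := mul_pos (pow_pos hε₂pos 2) hS₂pos
  have hP1 : 0 < ε₁ ^ 2 * S₁ := lt_of_lt_of_le hP2 hsum_mono
  have hS₁pos : 0 < S₁ := by
    by_contra h
    push Not at h
    nlinarith [mul_nonpos_of_nonneg_of_nonpos (sq_nonneg ε₁) h]
  have hA : 0 ≤ ‖a₀‖ ^ 2 := sq_nonneg _
  calc σ₁ ^ 2 * ‖star s ⬝ᵥ ψ₁‖ ^ 2 * ‖a₀‖ ^ 2 / ε₁ ^ 2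
      = (σ₁ ^ 2 * ‖star s ⬝ᵥ ψ₁‖ ^ 2 * S₁) * (‖a₀‖ ^ 2 / (ε₁ ^ 2 * S₁)) := by
        conv_rhs => rw [← mul_div_assoc, mul_right_comm _ S₁, mul_div_mul_right _ _ hS₁pos.ne']
    _ ≤ 1 * (‖a₀‖ ^ 2 / (ε₁ ^ 2 * S₁)) :=
        mul_le_mul_of_nonneg_right hS1 (div_nonneg hA hP1.le)
    _ ≤ 1 * (‖a₀‖ ^ 2 / (ε₂ ^ 2 * S₂)) :=
        mul_le_mul_of_nonneg_left (div_le_div_of_nonneg_left hA hP2 hsum_mono) zero_le_one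
    _ = (σ₂ ^ 2 * ‖star s ⬝ᵥ ψ₂‖ ^ 2 * S₂) * (‖a₀‖ ^ 2 / (ε₂ ^ 2 * S₂)) := by rw [hS2]
    _ = σ₂ ^ 2 * ‖star s ⬝ᵥ ψ₂‖ ^ 2 * ‖a₀‖ ^ 2 / ε₂ ^ 2 := by
        rw [← mul_div_assoc, mul_right_comm _ S₂, mul_div_mul_right _ _ hS₂pos.ne']

end Summit.HubbardSuperconductivity.HubbardSuperconductivity.Theorems.AnisotropyChord
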